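import Literature.NumberTheory.Rogawski1990.DepthZeroKappaTransferTypeTwoGSideEisenstein     -- ★ p853449 (B3) the F5 HEAD: G-side over the Eisenstein block + `…_of_valued_two` (free row by ★ p853295); brings ★ GSide §1–§3
import Literature.NumberTheory.Rogawski1990.DepthZeroKappaTransferTypeTwo                      -- ★ the tame clause (its imports: near-1 package, `v_charpoly_coeff_le_one_of_residuallyUnipotent`, place API)
import Literature.NumberTheory.Rogawski1990.DepthZeroTransferHValuesTypeTwoEisenstein           -- (this seat) H² `…indicator∕chiZero∕chiOne…_of_eisensteinBlock` (over ★ p853441 ∕ p853455)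
import Literature.NumberTheory.Automorphic.UnitaryRankTwoCentralizerCompactness                 -- ★ `compactSpace_centralizer_cmDatum_two_of_not_exists_isRoot` (any residue characteristic)
import Literature.NumberTheory.Rogawski1990.TypeTwoEisensteinData                               -- ★ F2 p852809: `exists_v_eq_exp_neg_nat`
import Literature.NumberTheory.Rogawski1990.TypeTwoEisensteinDataAtPlace                        -- (P2d-α) LH10-p01 (g12): `exists_eisensteinData_at_place` (★ F2 `exists_eisensteinData` through the square-class split ★ α1∕α2 + ★ (O-4))
import HarnessLib

/-!
# T3′ (P-2) at EVERY unramified non-split place: the depth-zero κ-transfer at the hyperspecial vertex, TYPE TWO, with `|2| = 1` deleted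

Topic `NumberTheory/Rogawski1990`; namespace `Literature.NumberTheory.Rogawski1990`.  THEOREMS ONLY (no definition, no instance, no notation, no named fact, no `sorry`); kernel lane `--supports stmt-HodgeConjecture-24833`.  Cell `pub/hodgecm-mathlib`, crux H413, half-A line LH4; road M6 → F5 → the DYADIC (P-2) CLAUSE
(SIG-F5 v2 §4–§5: «F5 ★ ⇒ a dyadic (P-2) clause ⇒ …»; split of record LH4 bus 03:58Z: (P2d-α) «Eisenstein data at the place» = LH10-p01 (g12), the clause = LH4-p01 (g11)).
HONEST LABEL: HC_CM is proved only modulo the cell's 2 remaining named inputs (hLiu418 24832, h413 24833) until rung 0 closes; count-neutral: the `stub_N6nsDyadic` rider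
needs the rest of the dyadic chain (SIG-F5 v2 §4) and is the desk's to price; this file asserts nothing printed — it is an assembly of ★ organs.

THE STATEMENT (`depthZeroKappaTransfer_hyperspecial_typeTwo_of_isUnramifiedIn`) = ★ `depthZeroKappaTransfer_hyperspecial_typeTwo` (`DepthZeroKappaTransferTypeTwo` :56)
with the binder `h2 : IsUnit (2 : 𝒪_w)` (:64) DELETED; every other binder and the conclusion VERBATIM.
THE PROOF = the tame proof (:118–:203) call by call: (0) `V`, `hint`, `hg1 hu1` — unchanged (2-free); (1) the exponents `(n, N)` and their law ↦ the EISENSTEIN DATA at `w`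
— (P2d-α) `exists_eisensteinData_at_place` (★ F2 `exists_eisensteinData` fed its seam binder `hram` by the square-class split of ★ α1∕α2 + ★ (O-4)) — delivering
`Θ α β a b n N` with `hΘ hΘd hΘt hrel hn hb hnN hpar` in ★ p853449's letters; `hn2` from ★ `valuation_quadratic_bounds_of_entrywise_deep` as before, `hN1` by `omega`;
(2) `[CompactSpace Z(γ₂)]` ↦ ★ `compactSpace_centralizer_cmDatum_two_of_not_exists_isRoot` (no `|2|`); (3) the G-side ↦ ★ p853449
`finsum_finExplicitDelta_mul_classOrbitalIntegral_depthZero_eq_of_eisensteinData_of_valued_two` (its dyadic parameter `|2|_v = q^(−e)` obtained here by ★ F2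
`exists_v_eq_exp_neg_nat`; `hdeep` = membership in ★ `setOf_residuallyUnipotent_endoEmbLocal_mem_nhds_one`); (4) the H-side ↦ ★ `…chiZero∕chiOne…_of_eisensteinBlock`
over the SAME block (radius `N = ord_w b`); (5) `push_cast; field_simp` verbatim.

## References
* [Rogawski1990] J. D. Rogawski, *Automorphic Representations of Unitary Groups in Three Variables*, Ann. of Math. Stud. 123 (1990): §4.9 Prop. 4.9.1 (a)(b) pp. 54–55,
  Lemma 4.9.3 p. 56; §4.3 (4.3.1)–(4.3.2) p. 43; §8.1 Prop. 8.1.1 p. 112.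
* [Flicker1998UnitaryFL] Y. Z. Flicker, *Elementary proof of the fundamental lemma for a unitary group*, Canad. J. Math. 50 (1998): Prop. 3 p. 78, §6 Thm. 18 p. 97.
* [LanglandsShelstad1987] R. P. Langlands, D. Shelstad, *On the definition of transfer factors*, Math. Ann. 278 (1987): §1.3–1.4.
* [Kottwitz1986BaseChangeUnits] R. Kottwitz, *Base change for unit elements of Hecke algebras*, Compositio Math. 60 (1986): §1 pp. 240–241.
* [SerreLocalFields1979] J.-P. Serre, *Local Fields*, GTM 67 (1979): Ch. I §6 Prop. 17–18.
-/

set_option autoImplicit false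

noncomputable section

open MeasureTheory Measure Set Function NumberField IsDedekindDomain Matrix Polynomial Topology Filter
open Literature.NumberTheory.Automorphic Literature.NumberTheory.Automorphic.UnitaryGroup
open Literature.NumberTheory.Automorphic.IntegralReduction Literature.NumberTheory.GaloisRepresentations
open scoped Matrix MatrixGroups ValuativeRel

namespace Literature.NumberTheory.Rogawski1990

/-! ## The clause -/

set_option maxHeartbeats 800000 in
open scoped Classical in
/-- **T3′ HEAD v4, CLAUSE (P-2) TYPE TWO AT EVERY UNRAMIFIED NON-SPLIT PLACE** (the `|2|`-free twin of ★ `depthZeroKappaTransfer_hyperspecial_typeTwo`: binders =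
its binders with `h2 : IsUnit (2 : 𝒪_w)` DELETED, conclusion VERBATIM).  At a non-split place `v` of good reduction unramified in `L` (ANY residue characteristic), for a
depth-zero piece `g` at the hyperspecial vertex, arbitrary Haar measures and the canonical orbital-measure families: there is `V ∈ 𝓝 (1 : H_v)` such that for every
`G`-regular `γ_H ∈ V` of TYPE TWO, `Σᶠ_c Δ‴_v(γ_H, c)·Φ(c, g) = a₀·Φ^st(γ_H, χ₀) + a₁·Φ^st(γ_H, χ₁)`.  Proof = the tame proof with the exponents `(n, N)` replaced by the
EISENSTEIN DATA at `w` ((P2d-α) `exists_eisensteinData_at_place`: ★ F2 `exists_eisensteinData` fed its seam binder by the square-class split), the G-side by ★ p853449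
`…_of_eisensteinData_of_valued_two`, the H-side by ★ `…chiZero∕chiOne…_of_eisensteinBlock` (this seat), the compact centraliser by ★ `compactSpace_centralizer_cmDatum_two_of_not_exists_isRoot`.
[cite: Rogawski1990, §4.9 Prop. 4.9.1 (a)(b) p. 55; §4.3 (4.3.1)–(4.3.2) p. 43; §8.1 Prop. 8.1.1 p. 112] [cite: Flicker1998UnitaryFL, §6 Thm. 18 p. 97] [cite: LanglandsShelstad1987, §1.3–1.4]
[cite: Kottwitz1986BaseChangeUnits, §1 pp. 240–241] -/
theorem depthZeroKappaTransfer_hyperspecial_typeTwo_of_isUnramifiedIn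
    (L : Type) [Field L] [NumberField L] [IsCMField L] (H' : Matrix (Fin 3) (Fin 3) L) (μ : HeckeCharacter L)
    {v : HeightOneSpectrum (𝓞 ↥(maximalRealSubfield L))}
    (hH' : (H'.map (cmConjRingHom L)).transpose = H') (w : PlacesOver L v)
    (hw : IsCMField.complexConj L • w.1 = w.1) (hv : Algebra.IsUnramifiedIn (𝓞 L) v.asIdeal)
    (hH'w : IsUnit (placeForm H' w.1)) (hH'i : hH'w.unit ∈ glInt 3 (w.1.adicCompletion L))
    (hμ : μ.IsUnramifiedAt w.1) (hμu : μ.IsUnitary)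
    (hμω : ∀ x : ideleGroup ↥(maximalRealSubfield L), μ (AdeleRing.ideleBaseChange ↥(maximalRealSubfield L) L x) = quadraticHeckeCharCM L x)
    [MeasurableSpace ((cmDatum L 3 H').Local v)] [BorelSpace ((cmDatum L 3 H').Local v)]
    [∀ γ : ((cmDatum L 3 H').Local v), MeasurableSpace (((cmDatum L 3 H').Local v) ⧸ Subgroup.centralizer ({γ} : Set ((cmDatum L 3 H').Local v)))]
    [∀ γ : ((cmDatum L 3 H').Local v), BorelSpace (((cmDatum L 3 H').Local v) ⧸ Subgroup.centralizer ({γ} : Set ((cmDatum L 3 H').Local v)))]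
    [MeasurableSpace ((cmDatum L 2 (Matrix.of fun i j : Fin 2 => if i.val + j.val + 1 = 2 then (1 : L) else 0)).Local v ×
      (cmDatum L 1 (Matrix.of fun i j : Fin 1 => if i.val + j.val + 1 = 1 then (1 : L) else 0)).Local v)]
    [BorelSpace ((cmDatum L 2 (Matrix.of fun i j : Fin 2 => if i.val + j.val + 1 = 2 then (1 : L) else 0)).Local v ×
      (cmDatum L 1 (Matrix.of fun i j : Fin 1 => if i.val + j.val + 1 = 1 then (1 : L) else 0)).Local v)]
    [∀ a : ((cmDatum L 2 (Matrix.of fun i j : Fin 2 => if i.val + j.val + 1 = 2 then (1 : L) else 0)).Local v ×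
      (cmDatum L 1 (Matrix.of fun i j : Fin 1 => if i.val + j.val + 1 = 1 then (1 : L) else 0)).Local v),
      MeasurableSpace (((cmDatum L 2 (Matrix.of fun i j : Fin 2 => if i.val + j.val + 1 = 2 then (1 : L) else 0)).Local v ×
      (cmDatum L 1 (Matrix.of fun i j : Fin 1 => if i.val + j.val + 1 = 1 then (1 : L) else 0)).Local v) ⧸ Subgroup.centralizer ({a} : Set ((cmDatum L 2 (Matrix.of fun i j : Fin 2 => if i.val + j.val + 1 = 2 then (1 : L) else 0)).Local v ×
      (cmDatum L 1 (Matrix.of fun i j : Fin 1 => if i.val + j.val + 1 = 1 then (1 : L) else 0)).Local v)))]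
    [∀ a : ((cmDatum L 2 (Matrix.of fun i j : Fin 2 => if i.val + j.val + 1 = 2 then (1 : L) else 0)).Local v ×
      (cmDatum L 1 (Matrix.of fun i j : Fin 1 => if i.val + j.val + 1 = 1 then (1 : L) else 0)).Local v),
      BorelSpace (((cmDatum L 2 (Matrix.of fun i j : Fin 2 => if i.val + j.val + 1 = 2 then (1 : L) else 0)).Local v ×
      (cmDatum L 1 (Matrix.of fun i j : Fin 1 => if i.val + j.val + 1 = 1 then (1 : L) else 0)).Local v) ⧸ Subgroup.centralizer ({a} : Set ((cmDatum L 2 (Matrix.of fun i j : Fin 2 => if i.val + j.val + 1 = 2 then (1 : L) else 0)).Local v ×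
      (cmDatum L 1 (Matrix.of fun i j : Fin 1 => if i.val + j.val + 1 = 1 then (1 : L) else 0)).Local v)))]
    (νH : Measure ((cmDatum L 2 (Matrix.of fun i j : Fin 2 => if i.val + j.val + 1 = 2 then (1 : L) else 0)).Local v ×
      (cmDatum L 1 (Matrix.of fun i j : Fin 1 => if i.val + j.val + 1 = 1 then (1 : L) else 0)).Local v)) [νH.IsHaarMeasure] [νH.IsMulRightInvariant]
    (νG : Measure ((cmDatum L 3 H').Local v)) [νG.IsHaarMeasure] [νG.IsMulRightInvariant]
    {mH : OrbitalMeasureFamily ((cmDatum L 2 (Matrix.of fun i j : Fin 2 => if i.val + j.val + 1 = 2 then (1 : L) else 0)).Local v ×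
      (cmDatum L 1 (Matrix.of fun i j : Fin 1 => if i.val + j.val + 1 = 1 then (1 : L) else 0)).Local v)} {mG : OrbitalMeasureFamily ((cmDatum L 3 H').Local v)}
    (hmH : mH.IsCanonical (IsLocalGRegular L v) νH)
    (hmG : mG.IsCanonical (fun γ => IsRegularElt (γ.val : GL (Fin 3) (UnitaryGroup.LocalRing L v))) νG)
    -- the depth-zero piece at the hyperspecial vertex: `C_c^∞`, supported in `K`, constant on the residually-unipotent Jordan strata of `K`
    (g : ((cmDatum L 3 H').Local v) → ℂ) (hg : IsLocSmooth g) (hgK : tsupport g ⊆ (cmLocalIntegralLevel L 3 H' v : Set ((cmDatum L 3 H').Local v)))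
    (hginv : ∀ u ∈ cmLocalIntegralLevel L 3 H' v, ∀ x, g (u * x * u⁻¹) = g x)
    (c : ℕ → ℂ)
    (hc : ∀ k ∈ cmLocalIntegralLevel L 3 H' v,
      (redMat (((k.val : GL (Fin 3) (UnitaryGroup.LocalRing L v)).val.map (Pi.evalRingHom (fun w' : PlacesOver L v => w'.1.adicCompletion L) w))) - 1) ^ 3 = 0 →
      g k = c (redMat (((k.val : GL (Fin 3) (UnitaryGroup.LocalRing L v)).val.map (Pi.evalRingHom (fun w' : PlacesOver L v => w'.1.adicCompletion L) w))) - 1).rank) :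
    ∃ V ∈ 𝓝 (1 : ((cmDatum L 2 (Matrix.of fun i j : Fin 2 => if i.val + j.val + 1 = 2 then (1 : L) else 0)).Local v ×
        (cmDatum L 1 (Matrix.of fun i j : Fin 1 => if i.val + j.val + 1 = 1 then (1 : L) else 0)).Local v)),
      ∀ γH ∈ V, IsLocalGRegular L v γH →
        ¬ (∃ x : w.1.adicCompletion L, (((γH.1.val : GL (Fin 2) (UnitaryGroup.LocalRing L v)).val.map
          (Pi.evalRingHom (fun w' : PlacesOver L v => w'.1.adicCompletion L) w)).charpoly).IsRoot x) →
        ∑ᶠ cG : ConjClasses ((cmDatum L 3 H').Local v),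
            ((finExplicitCollection L H' μ (finExplicitDelta_conj_left_all L H' μ) (finExplicitDelta_conj_right_all L H' μ)) v).Δ γH (Quotient.out cG) *
              classOrbitalIntegral mG g cG =
          -- `a₀ · Φ^st(γH, χ₀)`, `a₀ = (ν_G(K)∕ν_H(K_H)) · (q⁻² c 0 + ((q²−1)∕q²) c 1)`, `χ₀ = 1_{{h ∈ K_H : h̄_W = 1}}`
          ((νG.real (cmLocalIntegralLevel L 3 H' v : Set ((cmDatum L 3 H').Local v)) / νH.real (((cmLocalIntegralLevel L 2 (Matrix.of fun i j : Fin 2 => if i.val + j.val + 1 = 2 then (1 : L) else 0) v).prod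
                (cmLocalIntegralLevel L 1 (Matrix.of fun i j : Fin 1 => if i.val + j.val + 1 = 1 then (1 : L) else 0) v) : Subgroup _) : Set _) : ℝ) : ℂ) * (((Ideal.absNorm v.asIdeal : ℂ) ^ 2)⁻¹ * c 0 + (((Ideal.absNorm v.asIdeal : ℂ) ^ 2 - 1) / (Ideal.absNorm v.asIdeal : ℂ) ^ 2) * c 1) *
              stableOrbitalIntegralRel (IsLocalStablyConjH L v) mH
                ((((cmLocalIntegralLevel L 2 (Matrix.of fun i j : Fin 2 => if i.val + j.val + 1 = 2 then (1 : L) else 0) v).prod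
                (cmLocalIntegralLevel L 1 (Matrix.of fun i j : Fin 1 => if i.val + j.val + 1 = 1 then (1 : L) else 0) v) : Subgroup _) : Set _).indicator
              (fun h => if (redMat (((h.1.val : GL (Fin 2) (UnitaryGroup.LocalRing L v)).val.map (Pi.evalRingHom (fun w' : PlacesOver L v => w'.1.adicCompletion L) w))) - 1) ^ 2 = 0 ∧ (redMat (((h.1.val : GL (Fin 2) (UnitaryGroup.LocalRing L v)).val.map (Pi.evalRingHom (fun w' : PlacesOver L v => w'.1.adicCompletion L) w))) - 1).rank = 0 then (1 : ℂ) else 0)) γH +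
          -- `a₁ · Φ^st(γH, χ₁)`, `a₁ = (ν_G(K)∕ν_H(K_H)) · (−q⁻¹ c 1 + ((q+1)∕q) c 2)`, `χ₁ = 1_{{h ∈ K_H : h̄_W unipotent, rank(h̄_W − 1) = 1}}`
          ((νG.real (cmLocalIntegralLevel L 3 H' v : Set ((cmDatum L 3 H').Local v)) / νH.real (((cmLocalIntegralLevel L 2 (Matrix.of fun i j : Fin 2 => if i.val + j.val + 1 = 2 then (1 : L) else 0) v).prod
                (cmLocalIntegralLevel L 1 (Matrix.of fun i j : Fin 1 => if i.val + j.val + 1 = 1 then (1 : L) else 0) v) : Subgroup _) : Set _) : ℝ) : ℂ) * (-((Ideal.absNorm v.asIdeal : ℂ))⁻¹ * c 1 + (((Ideal.absNorm v.asIdeal : ℂ) + 1) / (Ideal.absNorm v.asIdeal : ℂ)) * c 2) *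
              stableOrbitalIntegralRel (IsLocalStablyConjH L v) mH
                ((((cmLocalIntegralLevel L 2 (Matrix.of fun i j : Fin 2 => if i.val + j.val + 1 = 2 then (1 : L) else 0) v).prod
                (cmLocalIntegralLevel L 1 (Matrix.of fun i j : Fin 1 => if i.val + j.val + 1 = 1 then (1 : L) else 0) v) : Subgroup _) : Set _).indicator
              (fun h => if (redMat (((h.1.val : GL (Fin 2) (UnitaryGroup.LocalRing L v)).val.map (Pi.evalRingHom (fun w' : PlacesOver L v => w'.1.adicCompletion L) w))) - 1) ^ 2 = 0 ∧ (redMat (((h.1.val : GL (Fin 2) (UnitaryGroup.LocalRing L v)).val.map (Pi.evalRingHom (fun w' : PlacesOver L v => w'.1.adicCompletion L) w))) - 1).rank = 1 then (1 : ℂ) else 0)) γH := by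
  haveI := Literature.NumberTheory.Automorphic.isAdicComplete_maximalIdeal_valuedInteger_adicCompletion L w.1
  have _hμu := hμu  -- a binder of the clause text (HEAD v4 VERBATIM) not needed by the proof
  have hH'σ : (H'.map (IsCMField.complexConj L))ᵀ = H' := hH'
  have hiso := ValuativeRel.isEquiv (ValuativeRel.valuation (w.1.adicCompletion L))
    (Valued.v : Valuation (w.1.adicCompletion L) (WithZero (Multiplicative ℤ)))
  -- `H′` is invertible: its image over `L_w` is
  have hH'u : IsUnit H' := by
    rw [Matrix.isUnit_iff_isUnit_det]
    have h := (Matrix.isUnit_iff_isUnit_det _).1 hH'w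
    rw [show placeForm H' w.1 = (algebraMap L (w.1.adicCompletion L)).mapMatrix H' from rfl, ← RingHom.map_det] at h
    exact isUnit_iff_ne_zero.2 fun h0 => h.ne_zero (by rw [h0, map_zero])
  -- the dyadic PARAMETER `|2|_v = q^(−e)` (char 0: `2 ≠ 0`; `e = 0` off `2`) — the only place `2` is read, and only by the G-side's row-2 count
  obtain ⟨e, he⟩ : ∃ e : ℕ, Valued.v (2 : v.adicCompletion ↥(maximalRealSubfield L)) = WithZero.exp (-(e : ℤ)) := by
    haveI : CharZero (v.adicCompletion ↥(maximalRealSubfield L)) := charZero_of_injective_algebraMap (algebraMap ↥(maximalRealSubfield L) _).injective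
    refine exists_v_eq_exp_neg_nat two_ne_zero ?_
    rw [show (2 : v.adicCompletion ↥(maximalRealSubfield L)) = 1 + 1 by norm_num]
    exact Valuation.map_add_le _ (le_of_eq (map_one _)) (le_of_eq (map_one _))
  -- the mass `ν_H(K_H) ≠ 0`
  have hKHpos : νH.real ((cmLocalIntegralLevel L 2 (Matrix.of fun i j : Fin 2 => if i.val + j.val + 1 = 2 then (1 : L) else 0) v :
        Set ((cmDatum L 2 (Matrix.of fun i j : Fin 2 => if i.val + j.val + 1 = 2 then (1 : L) else 0)).Local v)) ×ˢ
      (cmLocalIntegralLevel L 1 (Matrix.of fun i j : Fin 1 => if i.val + j.val + 1 = 1 then (1 : L) else 0) v :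
        Set ((cmDatum L 1 (Matrix.of fun i j : Fin 1 => if i.val + j.val + 1 = 1 then (1 : L) else 0)).Local v))) ≠ 0 := by
    have hK2 := isCompact_isOpen_cmLocalIntegralLevel L 2 (Matrix.of fun i j : Fin 2 => if i.val + j.val + 1 = 2 then (1 : L) else 0) v
    have hK1 := isCompact_isOpen_cmLocalIntegralLevel L 1 (Matrix.of fun i j : Fin 1 => if i.val + j.val + 1 = 1 then (1 : L) else 0) v
    rw [measureReal_def]
    exact (ENNReal.toReal_pos ((hK2.2.prod hK1.2).measure_pos νH ⟨(1, 1), Subgroup.one_mem _, Subgroup.one_mem _⟩).ne'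
      (hK2.1.prod hK1.1).measure_lt_top.ne).ne'
  -- the uniformizer `ϖ_v` read at `w` (`|ϖ|_w = q⁻¹`, `v` unramified in `L`)
  have hϖ1 := Liu2021.LemD1IndexedNonVacuityInertCofinite.valued_toPlace_uniformizer_of_isUnramifiedIn L v hv w
  have hϖ0 : (toPlace v w (HeckeCharacter.uniformizer ↥(maximalRealSubfield L) v : v.adicCompletion ↥(maximalRealSubfield L))) ≠ 0 :=
    fun h0 => by rw [h0, map_zero] at hϖ1; exact WithZero.zero_ne_coe hϖ1
  -- (0) the neighbourhood: residually unipotent `ι_v(γ_H)`, and `g_w ≡ 1` entrywise, `u_w ≡ 1 (mod ϖ_v)` (★ part 1∕2 §3) — 2-free, verbatim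
  have hV₁ := setOf_entrywise_deep_mem_nhds_one L v w hϖ0
  refine ⟨_ ∩ _, Filter.inter_mem (setOf_residuallyUnipotent_endoEmbLocal_mem_nhds_one L v w) hV₁, ?_⟩
  intro γH hγV hreg hirr
  obtain ⟨hγ0, hγ1⟩ := hγV
  simp only [Set.mem_setOf_eq] at hγ0 hγ1
  have hg1 : ∀ i j, Valued.v ((((γH.1.val : GL (Fin 2) (LocalRing L v)).val.map (Pi.evalRingHom (fun w' : PlacesOver L v => w'.1.adicCompletion L) w)) - 1) i j) ≤
      WithZero.exp (-1 : ℤ) := fun i j => by rw [← hϖ1]; exact hγ1.1 i j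
  have hu1 : Valued.v (finGammaTwo L v γH w - 1) ≤ WithZero.exp (-1 : ℤ) := by rw [← hϖ1]; exact hγ1.2
  -- keep the (large) goal out of the eliminators' motives while gathering the data; it comes back at `apply hneg`
  by_contra hneg
  -- integrality of `charpoly(ι_v γ_H)_w` in both currencies; `|det g_w| ≤ 1`, `|u_w| = 1`
  have hintV : ∀ i : ℕ, ((((endoEmbLocal L v γH).val : GL (Fin 3) (UnitaryGroup.LocalRing L v)).val.map
      (Pi.evalRingHom (fun w' : PlacesOver L v => w'.1.adicCompletion L) w)).charpoly.coeff i) ∈ Valued.integer (w.1.adicCompletion L) :=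
    fun i => (Valuation.mem_integer_iff _ _).2 (v_charpoly_coeff_le_one_of_residuallyUnipotent _ hγ0 i)
  obtain ⟨htrg, hδ⟩ := valued_trace_le_one_and_valued_det_le_one_of_hint L v w hw (a := γH) hintV
  have hu : Valued.v (finGammaTwo L v γH w) ≤ 1 := (valued_finGammaTwo_apply_eq_one L v w hw (a := γH)).le
  -- (1) THE EISENSTEIN DATA AT `w` ((P2d-α): ★ F2 `exists_eisensteinData` through the square-class split) — replaces the tame `exists_irredExponents_of_hint … h2 …`
  obtain ⟨Θ, α, β, a, b, n, N, hΘ, hΘd, hΘt, hrel, hn, hb, hnN, hpar⟩ :=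
    exists_eisensteinData_at_place L w hw hv hirr htrg hδ hu hϖ1
  -- `2 ≤ n`, `1 ≤ N`, `tr ≡ 2`, `det ≡ 1` from the entrywise depth (★ part 1∕2 §2) and `n ≤ 2N+1`
  obtain ⟨hχ, -, htr, hdet⟩ := valuation_quadratic_bounds_of_entrywise_deep
    (((γH.1.val : GL (Fin 2) (LocalRing L v)).val.map (Pi.evalRingHom (fun w' : PlacesOver L v => w'.1.adicCompletion L) w))) (finGammaTwo L v γH w) hg1 hu1
  have hn2 : 2 ≤ n := by
    rw [← eval_finCharpolyTwo_finGammaTwo_apply_eq_quadratic, hn, WithZero.exp_le_exp] at hχ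
    omega
  have hN1 : 1 ≤ N := by omega
  have htr' : Valued.v ((((γH.1.val : GL (Fin 2) (UnitaryGroup.LocalRing L v)).val.map (Pi.evalRingHom (fun w' : PlacesOver L v => w'.1.adicCompletion L) w))).trace - 2) < 1 :=
    lt_of_le_of_lt htr (by rw [← WithZero.exp_zero, WithZero.exp_lt_exp]; norm_num)
  have hdet' : Valued.v ((((γH.1.val : GL (Fin 2) (UnitaryGroup.LocalRing L v)).val.map (Pi.evalRingHom (fun w' : PlacesOver L v => w'.1.adicCompletion L) w))).det - 1) < 1 :=
    lt_of_le_of_lt hdet (by rw [← WithZero.exp_zero, WithZero.exp_lt_exp]; norm_num)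
  -- the compact centraliser of `γ₂` (anisotropic torus) — ★ `compactSpace_centralizer_cmDatum_two_of_not_exists_isRoot` (any residue characteristic)
  have hΦ₂ : (Matrix.of fun i j : Fin 2 => if i.val + j.val + 1 = 2 then (1 : L) else 0).det ≠ 0 := by
    rw [Matrix.det_fin_two]; simp
  haveI := compactSpace_centralizer_cmDatum_two_of_not_exists_isRoot L v w hw hΦ₂ γH.1 hirr
  -- (2)–(5) the G-side ★ p853449 (free row by ★ p853295 at `|2|_v = q^(−e)`) and the H-side values over the SAME Eisenstein block, then the mass algebra
  apply hneg
  rw [finsum_finExplicitDelta_mul_classOrbitalIntegral_depthZero_eq_of_eisensteinData_of_valued_two L H' hH'σ w hw hv hH'w hH'i μ hμ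
      (finExplicitDelta_conj_left_all L H' μ) (finExplicitDelta_conj_right_all L H' μ) hH'u hμω hreg hirr hγ0 n N hn he hϖ1 hΘ hΘd hΘt hrel hb hn2 hN1 hnN hpar hg1 hu1
      νG hmG g hg hgK hginv c hc,
    stableOrbitalIntegralRel_chiZero_eq_mul_phiHtwo_of_eisensteinBlock L v w hw νH hv hmH hreg hirr hϖ1 hΘd hΘt hrel hb hu hN1 htr' hdet' _,
    stableOrbitalIntegralRel_chiOne_eq_mul_phiHtwo_sub_of_eisensteinBlock L v w hw νH hv hmH hreg hirr hϖ1 hΘd hΘt hrel hb hu hN1 htr' hdet' _ _]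
  have hKHc := Complex.ofReal_ne_zero.2 hKHpos
  push_cast
  field_simp
  -- what is left: the decidability binders of the H² heads' `χ₀`, `χ₁` (any instances)
  all_goals exact fun _ => inferInstance

end Literature.NumberTheory.Rogawski1990

end
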